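import Mathlib
import HarnessLib
import Summits.HubbardSuperconductivity.HubbardSuperconductivity.Theorems.KLProgrammeKLRegimeEngineTowerInstProfileLevRate
import Summits.HubbardSuperconductivity.HubbardSuperconductivity.Theorems.KLProgrammeKLRegimeEngineTowerInstRemeasureLevBase
import Summits.HubbardSuperconductivity.HubbardSuperconductivity.Theorems.KLProgrammeKLRegimeEngineTowerLevLawBase

/-!
# Route `KLProgramme` — crux K3 ENGINE (stmt-HubbardSuperconductivity-20437 `KLRegimeEngineV17F2`), stub (b) v2, THE LEVELS PACKAGE (ℓ), instantiation (I2)/(I3):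
# THE RE-BASED LEVELLED MEASURED PROFILE WITH THE BLOCK RATE KEPT — base `𝒱_d` at `F_{d−1}` (cure (A″) of located-risk #8 «(ℓ)-BLOCK0-LOGM»;
# the PRODUCER of the bridge `hR` of `klTowerBLev_le_law_of_inputs_base`, …TowerLevLawBase; cell gate-hubbard-kl, seat p4 g19)

Base twin of …TowerInstProfileLevRate (p4 g18): the UV datum `N₀ t p` at the family `F_0` with its law `N₀/unit_t(p,0) ≤ A_uv λ^{p−1} Q_uv^p` is replaced by
the BASE datum `N_b t p` — a bound of the levelled norms of `𝒱_d = klTowerInput … d 1` at `F_{d−1}`, level `t+1`, degree `2p` (k3c2-p3's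
`klLevNormOf_le_of_wtPinned`, p668143, from p3's grid step p668311) — with its law `N_b t p / unit_t(p, d−1) ≤ A_b λ^{p−1} Q_b^p` (k3c2-p3's
`gridLaw_div_klLevUnit_le`, p670020: `A_b = 2^{7(d−1)}Aλ`, `Q_b = P/(8^{d−1}λ)`), and the law on the born arrays is assumed on the blocks `2 ≤ k′ ≤ k` only
(the increments `Δ_{k′}`, `1 ≤ k′ < k`).  For `k ≥ 2` the base term carries the gain `((√2)^{2p+t−6})⁻¹^{d(k−1)} ≤ γ^{2p+t−6}` exactly as the UV term did, so the
constants are UNCHANGED: for every `(t, p) ≠ (0, 3)`, `3 ≤ p ≤ D`,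
`klTowerMuLevAt … d t k p ≤ A′λ^{p−1}Q′^p`, `A′ = 27⁵(C₁/C₂)8^{d−1}(A_b + A/(1 − ((√2)^d)⁻¹))`, `Q′ = C₂²(2^{d−1})⁻¹·max Q Q_b`.

* §1 **`klTowerMuLevAt_le_profileR_base`** (per track, capped), §2 **`klTowerMuLev_le_profileR_base`** (track-blind: `m ≥ 4`; `m = 3` modulo the located six-leg
  cell `klTowerMuLevAt … d 0 k 3` = «(I2)-F1-HMU», unchanged by the re-basing);
* §3 **`klTowerBLev_le_law_of_base_rows`** — THE RE-BASED LEVELLED LAW WITH THE BRIDGE DISCHARGED: `klTowerBLev_le_law_of_inputs_base` (…TowerLevLawBase)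
  with its `hR` supplied by §2 (scaled by `W·Z^m`, constants dominated by `A′, Q′` exactly as in `…_uv`); remaining NAMED inputs = the base datum rows
  `N_b` / its unit law (k3c2-p3 p668143 / p670020 + p3's grid step), the block-`1` profile `hbase/hbase3`, the imports (E1 (I4)), the six-leg cell `X`, the
  step at blocks `k ≥ 1` (p664283 / p666413 §1 verbatim) and the kit's numerics (E1 (I5)).
Compositions of landed theorems and real algebra; nothing about the model is asserted beyond them; nothing asserts (ℓ), any stub, K3 or superconductivity.
References: BGM 2006 §2.8 (2.83), (2.93)–(2.98) [cite: BenfattoGiulianiMastropietro2006].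
-/

noncomputable section

namespace Summit.HubbardSuperconductivity.HubbardSuperconductivity.Theorems.EngineV8

set_option linter.dupNamespace false -- summit = problem name (single-conjunct summit), D-0017

open Classical
open Real Finset Literature.MathematicalPhysics.QuantumLattice Literature.Probability.LatticeModels GrassmannAlgebra
open Literature.MathematicalPhysics.QuantumLattice.FermiRG
open Summit.HubbardSuperconductivity.HubbardSuperconductivity.Theorems.KLProgrammeLegKernels
open Summit.HubbardSuperconductivity.HubbardSuperconductivity.Theorems.KLRegimeSplit
open Summit.HubbardSuperconductivity.HubbardSuperconductivity.Theorems.KLRegimeWick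
open Summit.HubbardSuperconductivity.HubbardSuperconductivity.Theorems.TorusFourierL2
open Summit.HubbardSuperconductivity.HubbardSuperconductivity.Theorems.DispersionFlow
open Summit.HubbardSuperconductivity.HubbardSuperconductivity.Theorems.PerturbedFermiCurve

variable {L M : ℕ} [NeZero L] [NeZero M]

/-! ## §1 The per-track re-based profile with the rate, capped -/

omit [NeZero L] [NeZero M] in
/-- **THE RE-BASED LEVELLED MEASURED PROFILE FROM THE LAW, per track, RATE KEPT.**  Under the binders of `klTowerMuLevAt_le_kitSum_base`, for `d ≥ 2`, `k ≥ 2`,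
`dk − 1 ≤ nScales β + 1`, a degree cap `D`, nonnegative `A, λ, Q, A_b, Q_b`, base bounds `N_b t p` (levelled norms of `𝒱_d` at `F_{d−1}`) with the base law
`N_b t p / klLevUnit … t p (d−1) ≤ A_b λ^{p−1} Q_b^p` (`3 ≤ p`) and the law `klTowerBLev … d t k′ p ≤ A λ^{p−1} Q^p` on the blocks `2 ≤ k′ ≤ k` (all tracks,
`3 ≤ p ≤ D`): for every `t : Fin 5`, `3 ≤ p ≤ D` with `2p + t ≥ 7`,
`klTowerMuLevAt … d t k p ≤ 27⁵(C₁/C₂)·8^{d−1}·(A_b + A/(1 − ((√2)^d)⁻¹))·λ^{p−1}·(C₂²(2^{d−1})⁻¹·max Q Q_b)^p`. [cite: BenfattoGiulianiMastropietro2006, §2.8 (2.83), (2.93)-(2.98)] -/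
theorem klTowerMuLevAt_le_profileR_base :
    ∃ C₁ C₂ : ℝ, 0 < C₁ ∧ 0 < C₂ ∧ ∀ R : RenConsts, R.WF2 → ∃ c₃' : ℝ, 0 < c₃' ∧ ∃ U₀' : ℝ, 0 < U₀' ∧
      ∀ (P : SplitConsts) (c : ℝ), P.WF → 0 < c → c ≤ klEngC₃6 P R → c ≤ c₃' →
      ∀ μ ∈ klWindowC, ∀ U : ℝ, 0 < U → U ≤ klEngU₀9 P R c → U ≤ U₀' → ∀ β : ℝ, klBetaMin ≤ β → β ≤ Real.exp (c / U ^ 2) →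
      ∀ K : TrigPolyC4v, FrameOK R U (nScales β) μ K → ∀ (L M : ℕ) [NeZero L] [NeZero M],
      klEngL₃ β U ≤ L → klEngM₃ β U L ≤ M → ∀ d k : ℕ, 2 ≤ d → 2 ≤ k → d * k - 1 ≤ nScales β + 1 → ∀ D : ℕ,
      ∀ (A lam Q Ab Qb : ℝ), 0 ≤ A → 0 ≤ lam → 0 ≤ Q → 0 ≤ Ab → 0 ≤ Qb →
      ∀ Nb : Fin 5 → ℕ → ℝ, (∀ t p, 0 ≤ Nb t p) →
        (∀ (t : Fin 5) (p : ℕ) (Ωe' : Fin (2 * p) → Option (SectorLeg (sectorCount (d - 1)))), levelCount Ωe' = (t : ℕ) + 1 →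
          klLevNormOf L M β μ K (d - 1) (2 * p) (klTowerInput L M β U μ K d 1) Ωe' ≤ Nb t p) →
        (∀ (t : Fin 5) (p : ℕ), 3 ≤ p → Nb t p / klLevUnit β M t p (d - 1) ≤ Ab * lam ^ (p - 1) * Qb ^ p) →
        (∀ k' : ℕ, 2 ≤ k' → k' ≤ k → ∀ (t : Fin 5) (p : ℕ), 3 ≤ p → p ≤ D → klTowerBLev L M β U μ K d t k' p ≤ A * lam ^ (p - 1) * Q ^ p) →
      ∀ (t : Fin 5) (p : ℕ), 3 ≤ p → p ≤ D → 7 ≤ 2 * p + (t : ℕ) →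
        klTowerMuLevAt L M β U μ K d t k p ≤
          (27 : ℝ) ^ 5 * (C₁ / C₂) * (8 : ℝ) ^ (d - 1) * (Ab + A / (1 - (Real.sqrt 2 ^ d)⁻¹)) * lam ^ (p - 1) *
            (C₂ ^ 2 * ((2 : ℝ) ^ (d - 1))⁻¹ * max Q Qb) ^ p := by
  obtain ⟨C₁, C₂, hC₁, hC₂, h⟩ := klTowerMuLevAt_le_kitSum_base
  refine ⟨C₁, C₂, hC₁, hC₂, fun R hR2 => ?_⟩
  obtain ⟨c₃, hc₃, U₀, hU₀, h'⟩ := h R hR2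
  refine ⟨c₃, hc₃, U₀, hU₀, ?_⟩
  intro P c hP hc hc6 hc₃' μ hμ U hU hU9 hU₀' β hβmin hβc K hK L M _ _ hL3 hM3 d k hd hk2 hkN D A lam Q Ab Qb hA hlam hQ hAb hQb Nb hNb0 hcar hlawb hIH
    t p hp hpD hpt
  have hβ : 0 < β := KLRegimeSplit.pos_of_klBetaMin_le hβmin
  have ht4 : (t : ℕ) ≤ 4 := by have := t.isLt; omega
  have hs1 : 1 ≤ Real.sqrt 2 := Real.one_le_sqrt.2 (by norm_num)
  have hs0 : 0 < Real.sqrt 2 := by positivity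
  -- the rate `ρ = ((√2)^d)⁻¹ ∈ (0, 1)` and the block gain `γ = ((√2)^{d−1})⁻¹ ≤ 1`
  set ρ : ℝ := (Real.sqrt 2 ^ d)⁻¹ with hρ
  have hsd1 : 1 < Real.sqrt 2 ^ d := by
    have h2 : Real.sqrt 2 ^ 2 = 2 := Real.sq_sqrt (by norm_num)
    calc (1 : ℝ) < 2 := by norm_num
      _ = Real.sqrt 2 ^ 2 := h2.symm
      _ ≤ Real.sqrt 2 ^ d := pow_le_pow_right₀ hs1 hd
  have hρ0 : 0 < ρ := by positivity
  have hρ1 : ρ < 1 := inv_lt_one_of_one_lt₀ hsd1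
  have hρle : ρ ≤ 1 := hρ1.le
  have h1ρ : 0 < 1 - ρ := sub_pos.2 hρ1
  set γ : ℝ := (Real.sqrt 2 ^ (d - 1))⁻¹ with hγ
  have hγ0 : 0 ≤ γ := by positivity
  have hγ1 : γ ≤ 1 := inv_le_one_of_one_le₀ (one_le_pow₀ hs1)
  -- the exponent `e = 2p + t − 6 ≥ 1` and the gain `G = γ^e`
  set e : ℕ := 2 * p + (t : ℕ) - 6 with he
  have he1 : 1 ≤ e := by omega
  set G : ℝ := γ ^ e with hG
  have hG0 : 0 ≤ G := by positivity
  have hGle : G ≤ (8 : ℝ) ^ (d - 1) * (((2 : ℝ) ^ (d - 1))⁻¹) ^ p := by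
    rw [hG, hγ, he]; exact rateGain_le hp
  have hmain := h' P c hP hc hc6 hc₃' μ hμ U hU hU9 hU₀' β hβmin hβc K hK L M hL3 hM3 d k hd hk2 hkN t p (by omega) (by omega) (Nb t p)
    (hNb0 t p) (hcar t p)
  rw [← he] at hmain
  -- laws
  set law : ℕ → ℝ := fun p => A * lam ^ (p - 1) * Q ^ p with hlaw
  have hlaw0 : 0 ≤ law p := by positivity
  have hu0 : 0 < klLevUnit β M t p (d - 1) := klLevUnit_pos hβ t p (d - 1)
  -- (i) the UV term carries `γ^e` (since `dk − 1 ≥ d − 1`)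
  have hUVt : (Real.sqrt 2 ^ e)⁻¹ ^ (d * (k - 1)) * (Nb t p / klLevUnit β M t p (d - 1)) ≤ G * (Ab * lam ^ (p - 1) * Qb ^ p) := by
    have hb : (Real.sqrt 2 ^ e)⁻¹ ≤ 1 := inv_le_one_of_one_le₀ (one_le_pow₀ hs1)
    have hb0 : 0 ≤ (Real.sqrt 2 ^ e)⁻¹ := by positivity
    have hdk : d - 1 ≤ d * (k - 1) := by
      have : d * 1 ≤ d * (k - 1) := Nat.mul_le_mul_left d (by omega)
      omega
    have hpow : (Real.sqrt 2 ^ e)⁻¹ ^ (d * (k - 1)) ≤ (Real.sqrt 2 ^ e)⁻¹ ^ (d - 1) := pow_le_pow_of_le_one hb0 hb hdk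
    have hGeq : (Real.sqrt 2 ^ e)⁻¹ ^ (d - 1) = G := by
      rw [hG, hγ, inv_pow, inv_pow, ← pow_mul, ← pow_mul, mul_comm]
    have hq0 : 0 ≤ Nb t p / klLevUnit β M t p (d - 1) := div_nonneg (hNb0 t p) hu0.le
    calc (Real.sqrt 2 ^ e)⁻¹ ^ (d * (k - 1)) * (Nb t p / klLevUnit β M t p (d - 1)) ≤ G * (Nb t p / klLevUnit β M t p (d - 1)) := by
          rw [← hGeq]; exact mul_le_mul_of_nonneg_right hpow hq0
      _ ≤ G * (Ab * lam ^ (p - 1) * Qb ^ p) := mul_le_mul_of_nonneg_left (hlawb t p hp) hG0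
  -- (ii) the born sum: each term `≤ G·ρ^{k−1−k′}·law`, the sum `≤ G·law/(1−ρ)`
  have hterm : ∀ k' ∈ Ico 1 k, Real.sqrt 2 ^ e * ρ ^ (e * (k - k')) * klTowerBLev L M β U μ K d t (k' + 1) p ≤ G * ρ ^ (k - 1 - k') * law p := by
    intro k' hk'
    obtain ⟨hk'1, hk'⟩ := mem_Ico.1 hk'
    obtain ⟨n, hn⟩ : ∃ n, k - k' = n + 1 := ⟨k - k' - 1, by omega⟩
    have hkn : k - 1 - k' = n := by omega
    have hb : klTowerBLev L M β U μ K d t (k' + 1) p ≤ law p := hIH (k' + 1) (by omega) (by omega) t p hp hpD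
    have hb0 : 0 ≤ klTowerBLev L M β U μ K d t (k' + 1) p := klTowerBLev_nonneg hβ U μ K d t (k' + 1) p
    have hrate : Real.sqrt 2 ^ e * ρ ^ (e * (k - k')) ≤ G * ρ ^ (k - 1 - k') := by
      rw [hn, hkn, show e * (n + 1) = e + e * n by ring, pow_add, ← mul_assoc]
      have h1 : Real.sqrt 2 ^ e * ρ ^ e = G := by rw [hG, hγ, hρ]; exact sqrt_two_pow_mul_inv_pow_eq (by omega) e
      have h2 : ρ ^ (e * n) ≤ ρ ^ n := by
        rw [mul_comm, pow_mul]
        exact pow_le_of_le_one (by positivity) (pow_le_one₀ hρ0.le hρle) (by omega)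
      rw [h1]
      exact mul_le_mul_of_nonneg_left h2 hG0
    calc Real.sqrt 2 ^ e * ρ ^ (e * (k - k')) * klTowerBLev L M β U μ K d t (k' + 1) p
        ≤ G * ρ ^ (k - 1 - k') * klTowerBLev L M β U μ K d t (k' + 1) p := mul_le_mul_of_nonneg_right hrate hb0
      _ ≤ G * ρ ^ (k - 1 - k') * law p := mul_le_mul_of_nonneg_left hb (by positivity)
  have hsum : ∑ k' ∈ Ico 1 k, Real.sqrt 2 ^ e * ρ ^ (e * (k - k')) * klTowerBLev L M β U μ K d t (k' + 1) p ≤ G * (law p / (1 - ρ)) := by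
    refine (sum_le_sum hterm).trans ?_
    have hsub : Ico 1 k ⊆ range k := fun k' hk' => mem_range.2 (mem_Ico.1 hk').2
    refine (sum_le_sum_of_subset_of_nonneg hsub (fun k' _ _ => by positivity)).trans ?_
    have hre : ∑ k' ∈ range k, G * ρ ^ (k - 1 - k') * law p = G * ((∑ j ∈ range k, ρ ^ j) * law p) := by
      rw [← sum_range_reflect (fun j => ρ ^ j) k, sum_mul, mul_sum]
      refine sum_congr rfl fun k' _ => ?_
      ring
    rw [hre]
    refine mul_le_mul_of_nonneg_left ?_ hG0
    calc (∑ j ∈ range k, ρ ^ j) * law p ≤ 1 / (1 - ρ) * law p :=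
          mul_le_mul_of_nonneg_right (geom_sum_range_le_inv_one_sub hρ0.le hρ1 k) hlaw0
      _ = law p / (1 - ρ) := by rw [one_div, inv_mul_eq_div]
  -- (iii) assemble
  have hpre0 : 0 ≤ (27 : ℝ) ^ ((t : ℕ) + 1) * (C₁ * C₂ ^ (2 * p - 1)) := by positivity
  have h27 : (27 : ℝ) ^ ((t : ℕ) + 1) ≤ 27 ^ 5 := pow_le_pow_right₀ (by norm_num) (by omega)
  set Mq := max Q Qb with hMq
  have hQM : Q ≤ Mq := le_max_left _ _
  have hQbM : Qb ≤ Mq := le_max_right _ _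
  have hMq0 : 0 ≤ Mq := hQ.trans hQM
  set δ : ℝ := ((2 : ℝ) ^ (d - 1))⁻¹ with hδ
  have hδ0 : 0 ≤ δ := by positivity
  have hin : Ab * lam ^ (p - 1) * Qb ^ p + law p / (1 - ρ) ≤ (Ab + A / (1 - ρ)) * lam ^ (p - 1) * Mq ^ p := by
    have h1 : Ab * lam ^ (p - 1) * Qb ^ p ≤ Ab * lam ^ (p - 1) * Mq ^ p :=
      mul_le_mul_of_nonneg_left (pow_le_pow_left₀ hQb hQbM p) (by positivity)
    have h2 : law p / (1 - ρ) ≤ A / (1 - ρ) * lam ^ (p - 1) * Mq ^ p := by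
      rw [hlaw]; dsimp only
      rw [div_eq_mul_inv, show A / (1 - ρ) * lam ^ (p - 1) * Mq ^ p = A * lam ^ (p - 1) * Mq ^ p * (1 - ρ)⁻¹ by ring]
      exact mul_le_mul_of_nonneg_right (mul_le_mul_of_nonneg_left (pow_le_pow_left₀ hQ hQM p) (by positivity))
        (inv_nonneg.2 h1ρ.le)
    calc Ab * lam ^ (p - 1) * Qb ^ p + law p / (1 - ρ) ≤ Ab * lam ^ (p - 1) * Mq ^ p + A / (1 - ρ) * lam ^ (p - 1) * Mq ^ p :=
          add_le_add h1 h2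
      _ = (Ab + A / (1 - ρ)) * lam ^ (p - 1) * Mq ^ p := by ring
  have hA0 : 0 ≤ Ab + A / (1 - ρ) := by have : 0 ≤ A / (1 - ρ) := div_nonneg hA h1ρ.le; positivity
  have hin0 : 0 ≤ (Ab + A / (1 - ρ)) * lam ^ (p - 1) * Mq ^ p := by positivity
  have hC : C₁ * C₂ ^ (2 * p - 1) = C₁ / C₂ * (C₂ ^ 2) ^ p := by
    have hpw : (C₂ ^ 2) ^ p = C₂ ^ (2 * p - 1) * C₂ := by
      rw [← pow_mul, ← pow_succ]; congr 1; omega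
    rw [hpw]
    field_simp
  calc klTowerMuLevAt L M β U μ K d t k p
      ≤ (27 : ℝ) ^ ((t : ℕ) + 1) * (C₁ * C₂ ^ (2 * p - 1)) *
          ((Real.sqrt 2 ^ e)⁻¹ ^ (d * (k - 1)) * (Nb t p / klLevUnit β M t p (d - 1)) +
            ∑ k' ∈ Ico 1 k, Real.sqrt 2 ^ e * ρ ^ (e * (k - k')) * klTowerBLev L M β U μ K d t (k' + 1) p) := hmain
    _ ≤ (27 : ℝ) ^ ((t : ℕ) + 1) * (C₁ * C₂ ^ (2 * p - 1)) * (G * (Ab * lam ^ (p - 1) * Qb ^ p) + G * (law p / (1 - ρ))) :=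
        mul_le_mul_of_nonneg_left (add_le_add hUVt hsum) hpre0
    _ = (27 : ℝ) ^ ((t : ℕ) + 1) * (C₁ * C₂ ^ (2 * p - 1)) * G * (Ab * lam ^ (p - 1) * Qb ^ p + law p / (1 - ρ)) := by ring
    _ ≤ (27 : ℝ) ^ 5 * (C₁ * C₂ ^ (2 * p - 1)) * ((8 : ℝ) ^ (d - 1) * δ ^ p) * ((Ab + A / (1 - ρ)) * lam ^ (p - 1) * Mq ^ p) := by
        have hsum0 : 0 ≤ Ab * lam ^ (p - 1) * Qb ^ p + law p / (1 - ρ) := add_nonneg (by positivity) (div_nonneg hlaw0 h1ρ.le)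
        have h1 : (27 : ℝ) ^ ((t : ℕ) + 1) * (C₁ * C₂ ^ (2 * p - 1)) * G ≤ 27 ^ 5 * (C₁ * C₂ ^ (2 * p - 1)) * ((8 : ℝ) ^ (d - 1) * δ ^ p) :=
          mul_le_mul (mul_le_mul_of_nonneg_right h27 (by positivity)) hGle hG0 (by positivity)
        exact mul_le_mul h1 hin hsum0 (by positivity)
    _ = (27 : ℝ) ^ 5 * (C₁ / C₂) * (8 : ℝ) ^ (d - 1) * (Ab + A / (1 - ρ)) * lam ^ (p - 1) * (C₂ ^ 2 * δ * Mq) ^ p := by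
        rw [hC, mul_pow, mul_pow]; ring

/-! ## §2 The track-blind re-based profile with the rate: `hprof`, `hprof3` modulo the located cell -/

omit [NeZero L] [NeZero M] in
/-- **THE TRACK-BLIND RE-BASED MEASURED PROFILE, RATE KEPT, capped** (`k ≥ 2`): (a) `m ∈ [4, D]`: `klTowerMuLev … d k m ≤ A′λ^{m−1}Q′^m`; (b) `m = 3 ≤ D`:
given `X ≥ klTowerMuLevAt … d 0 k 3` (the located cell), `klTowerMuLev … d k 3 ≤ max X (A′λ²Q′³)`; `A′ = 27⁵(C₁/C₂)8^{d−1}(A_b + A/(1−((√2)^d)⁻¹))`,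
`Q′ = C₂²(2^{d−1})⁻¹·max Q Q_b`. [cite: BenfattoGiulianiMastropietro2006, §2.8 (2.83), (2.93)-(2.98)] -/
theorem klTowerMuLev_le_profileR_base :
    ∃ C₁ C₂ : ℝ, 0 < C₁ ∧ 0 < C₂ ∧ ∀ R : RenConsts, R.WF2 → ∃ c₃' : ℝ, 0 < c₃' ∧ ∃ U₀' : ℝ, 0 < U₀' ∧
      ∀ (P : SplitConsts) (c : ℝ), P.WF → 0 < c → c ≤ klEngC₃6 P R → c ≤ c₃' →
      ∀ μ ∈ klWindowC, ∀ U : ℝ, 0 < U → U ≤ klEngU₀9 P R c → U ≤ U₀' → ∀ β : ℝ, klBetaMin ≤ β → β ≤ Real.exp (c / U ^ 2) →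
      ∀ K : TrigPolyC4v, FrameOK R U (nScales β) μ K → ∀ (L M : ℕ) [NeZero L] [NeZero M],
      klEngL₃ β U ≤ L → klEngM₃ β U L ≤ M → ∀ d k : ℕ, 2 ≤ d → 2 ≤ k → d * k - 1 ≤ nScales β + 1 → ∀ D : ℕ,
      ∀ (A lam Q Ab Qb : ℝ), 0 ≤ A → 0 ≤ lam → 0 ≤ Q → 0 ≤ Ab → 0 ≤ Qb →
      ∀ Nb : Fin 5 → ℕ → ℝ, (∀ t p, 0 ≤ Nb t p) →
        (∀ (t : Fin 5) (p : ℕ) (Ωe' : Fin (2 * p) → Option (SectorLeg (sectorCount (d - 1)))), levelCount Ωe' = (t : ℕ) + 1 →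
          klLevNormOf L M β μ K (d - 1) (2 * p) (klTowerInput L M β U μ K d 1) Ωe' ≤ Nb t p) →
        (∀ (t : Fin 5) (p : ℕ), 3 ≤ p → Nb t p / klLevUnit β M t p (d - 1) ≤ Ab * lam ^ (p - 1) * Qb ^ p) →
        (∀ k' : ℕ, 2 ≤ k' → k' ≤ k → ∀ (t : Fin 5) (p : ℕ), 3 ≤ p → p ≤ D → klTowerBLev L M β U μ K d t k' p ≤ A * lam ^ (p - 1) * Q ^ p) →
      (∀ m : ℕ, 4 ≤ m → m ≤ D →
        klTowerMuLev L M β U μ K d k m ≤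
          (27 : ℝ) ^ 5 * (C₁ / C₂) * (8 : ℝ) ^ (d - 1) * (Ab + A / (1 - (Real.sqrt 2 ^ d)⁻¹)) * lam ^ (m - 1) *
            (C₂ ^ 2 * ((2 : ℝ) ^ (d - 1))⁻¹ * max Q Qb) ^ m) ∧
      (∀ X : ℝ, 3 ≤ D → klTowerMuLevAt L M β U μ K d 0 k 3 ≤ X →
        klTowerMuLev L M β U μ K d k 3 ≤
          max X ((27 : ℝ) ^ 5 * (C₁ / C₂) * (8 : ℝ) ^ (d - 1) * (Ab + A / (1 - (Real.sqrt 2 ^ d)⁻¹)) * lam ^ 2 *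
            (C₂ ^ 2 * ((2 : ℝ) ^ (d - 1))⁻¹ * max Q Qb) ^ 3)) := by
  obtain ⟨C₁, C₂, hC₁, hC₂, h⟩ := klTowerMuLevAt_le_profileR_base
  refine ⟨C₁, C₂, hC₁, hC₂, fun R hR2 => ?_⟩
  obtain ⟨c₃, hc₃, U₀, hU₀, h'⟩ := h R hR2
  refine ⟨c₃, hc₃, U₀, hU₀, ?_⟩
  intro P c hP hc hc6 hc₃' μ hμ U hU hU9 hU₀' β hβmin hβc K hK L M _ _ hL3 hM3 d k hd hk2 hkN D A lam Q Ab Qb hA hlam hQ hAb hQb Nb hNb0 hcar hlawb hIH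
  have hcell := h' P c hP hc hc6 hc₃' μ hμ U hU hU9 hU₀' β hβmin hβc K hK L M hL3 hM3 d k hd hk2 hkN D A lam Q Ab Qb hA hlam hQ hAb hQb Nb hNb0 hcar hlawb hIH
  refine ⟨fun m hm hmD => ?_, fun X hD3 hX => ?_⟩
  · obtain ⟨t, ht⟩ := exists_klTowerMuLev_eq (L := L) (M := M) β U μ K d k m
    rw [ht]
    exact hcell t m (by omega) hmD (by omega)
  · obtain ⟨t, ht⟩ := exists_klTowerMuLev_eq (L := L) (M := M) β U μ K d k 3
    rw [ht]
    by_cases ht0 : (t : ℕ) = 0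
    · have : t = 0 := Fin.ext ht0
      rw [this]
      exact hX.trans (le_max_left _ _)
    · have h7 : 7 ≤ 2 * 3 + (t : ℕ) := by omega
      have := hcell t 3 le_rfl hD3 h7
      exact this.trans (le_max_right _ _)

/-! ## §3 The re-based levelled law with the bridge discharged -/

omit [NeZero L] [NeZero M] in
/-- **THE RE-BASED LEVELLED TOWER LAW, BRIDGE DISCHARGED** — `klTowerBLev_le_law_of_inputs_base` with `hR` from `klTowerMuLev_le_profileR_base`: under the
binders of the re-measurement rows, given the base datum `N_b` with its unit law, the block-`1` profile, the imports at `k ≥ 1`, the six-leg cell bound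
`klTowerMuLevAt … d 0 k 3 ≤ Xλ²` (`2 ≤ k < K_b`), the step at `k ≥ 1` and the kit's numerics at `A′ ≥ W·27⁵(C₁/C₂)8^{d−1}(A_b + A/(1−((√2)^d)⁻¹))`,
`Q′ ≥ Z·C₂²(2^{d−1})⁻¹·max Q Q_b`, `ι₃ ≥ max(WZ³X, A′Q′³)`: every born array of the blocks `2 ≤ k ≤ K_b` obeys `klTowerBLev … d t k p ≤ Aλ^{p−1}Q^p`.
[cite: BenfattoGiulianiMastropietro2006, §2.8 (2.83), (2.93)-(2.98)] -/
theorem klTowerBLev_le_law_of_base_rows :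
    ∃ C₁ C₂ : ℝ, 0 < C₁ ∧ 0 < C₂ ∧ ∀ R : RenConsts, R.WF2 → ∃ c₃' : ℝ, 0 < c₃' ∧ ∃ U₀' : ℝ, 0 < U₀' ∧
      ∀ (P : SplitConsts) (c : ℝ), P.WF → 0 < c → c ≤ klEngC₃6 P R → c ≤ c₃' →
      ∀ μ ∈ klWindowC, ∀ U : ℝ, 0 < U → U ≤ klEngU₀9 P R c → U ≤ U₀' → ∀ β : ℝ, klBetaMin ≤ β → β ≤ Real.exp (c / U ^ 2) →
      ∀ K : TrigPolyC4v, FrameOK R U (nScales β) μ K → ∀ (L M : ℕ) [NeZero L] [NeZero M],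
      klEngL₃ β U ≤ L → klEngM₃ β U L ≤ M → ∀ d Kb D : ℕ, 2 ≤ d → d * Kb - 1 ≤ nScales β + 1 → 3 ≤ D →
      ∀ (A lam Q Ab Qb : ℝ), 0 ≤ A → 0 < lam → 0 < Q → 0 ≤ Ab → 0 ≤ Qb →
      -- the base datum at the family `F_{d−1}` and its unit law (k3c2-p3 «(ℓ)-BASE-LEV» p668143 / p670020 from p3's grid step)
      ∀ Nb : Fin 5 → ℕ → ℝ, (∀ t p, 0 ≤ Nb t p) →
        (∀ (t : Fin 5) (p : ℕ) (Ωe' : Fin (2 * p) → Option (SectorLeg (sectorCount (d - 1)))), levelCount Ωe' = (t : ℕ) + 1 →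
          klLevNormOf L M β μ K (d - 1) (2 * p) (klTowerInput L M β U μ K d 1) Ωe' ≤ Nb t p) →
        (∀ (t : Fin 5) (p : ℕ), 3 ≤ p → Nb t p / klLevUnit β M t p (d - 1) ≤ Ab * lam ^ (p - 1) * Qb ^ p) →
      ∀ (W Z A' Q' : ℝ), 0 < W → 0 < Z →
        W * ((27 : ℝ) ^ 5 * (C₁ / C₂) * (8 : ℝ) ^ (d - 1) * (Ab + A / (1 - (Real.sqrt 2 ^ d)⁻¹))) ≤ A' →
        Z * (C₂ ^ 2 * ((2 : ℝ) ^ (d - 1))⁻¹ * max Q Qb) ≤ Q' → 0 < Q' →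
      ∀ (σ Φ ψ τ ι₁ ι₂ ι₃ X : ℝ), 0 ≤ σ → 0 ≤ Φ → 0 ≤ ψ → 0 < τ → W * Z ^ 3 * X ≤ ι₃ → A' * Q' ^ 3 ≤ ι₃ →
      -- the block-1 profile (named)
      (∀ m, 4 ≤ m → m ≤ D → W * Z ^ m * klTowerMuLev L M β U μ K d 1 m ≤ A' * lam ^ (m - 1) * Q' ^ m) →
      (3 ≤ D → W * Z ^ 3 * klTowerMuLev L M β U μ K d 1 3 ≤ ι₃ * lam ^ 2) →
      -- the imports (E1 (I4))
      (∀ k, 1 ≤ k → k < Kb → W * Z ^ 1 * klTowerMuLev L M β U μ K d k 1 ≤ ι₁ * lam) →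
      (∀ k, 1 ≤ k → k < Kb → W * Z ^ 2 * klTowerMuLev L M β U μ K d k 2 ≤ ι₂ * lam) →
      -- the located six-leg cell «(I2)-F1-HMU» at the blocks `k ≥ 2`
      (∀ k, 2 ≤ k → k < Kb → klTowerMuLevAt L M β U μ K d 0 k 3 ≤ X * lam ^ 2) →
      -- the step at blocks `k ≥ 1` (p664283 / p666413 §1 verbatim)
      (∀ t : Fin 5, ∀ k, 1 ≤ k → k < Kb → ∀ N : ℕ, 2 ≤ N → ∀ p, 3 ≤ p → p ≤ D →
        Φ * towerV D τ (fun m => W * Z ^ m * klTowerMuLev L M β U μ K d k m) < 1 →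
        klTowerBLev L M β U μ K d t (k + 1) p ≤
          towerFO D σ (fun m => W * Z ^ m * klTowerMuLev L M β U μ K d k m) p +
            ∑ n ∈ Icc 2 N, exp 1 * Φ ^ (n - 1) * ψ ^ p * towerS D τ (fun m => W * Z ^ m * klTowerMuLev L M β U μ K d k m) n p +
            ψ ^ p * exp 1 * towerV D τ (fun m => W * Z ^ m * klTowerMuLev L M β U μ K d k m) *
              (Φ * towerV D τ (fun m => W * Z ^ m * klTowerMuLev L M β U μ K d k m)) ^ N /
              (1 - Φ * towerV D τ (fun m => W * Z ^ m * klTowerMuLev L M β U μ K d k m))) →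
      -- the kit's numerics (E1 (I5))
      4 * σ * lam * Q' < 1 → 2 * lam * τ * Q' ≤ 1 → exp 1 * τ * lam * Q' < 1 →
      Φ * (τ * (ι₁ * lam + ι₂ / (2 * Q') + ι₃ / (4 * Q' ^ 2) + A' * Q' / 4)) < 1 →
      Φ * (exp 1 * τ * (ι₁ * lam) + (exp 1 * τ) ^ 2 * (ι₂ * lam) + (exp 1 * τ) ^ 3 * (ι₃ * lam ^ 2) +
        A' * (exp 1 * τ * Q') * ((exp 1 * τ * lam * Q') ^ 3 / (1 - exp 1 * τ * lam * Q'))) < 1 →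
      4 * Q' ≤ Q → 2 * τ * ψ * Q' ≤ Q →
      A' * (4 * Q') ^ 3 * (4 * σ * lam * Q' / (1 - 4 * σ * lam * Q')) +
        exp 1 * ψ * (2 * τ * ψ * Q') ^ 2 * (τ * (ι₁ * lam + ι₂ / (2 * Q') + ι₃ / (4 * Q' ^ 2) + A' * Q' / 4)) *
          (Φ * (τ * (ι₁ * lam + ι₂ / (2 * Q') + ι₃ / (4 * Q' ^ 2) + A' * Q' / 4)) /
            (1 - Φ * (τ * (ι₁ * lam + ι₂ / (2 * Q') + ι₃ / (4 * Q' ^ 2) + A' * Q' / 4)))) ≤ A * Q ^ 3 →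
      ∀ k, 2 ≤ k → k ≤ Kb → ∀ (t : Fin 5) (p : ℕ), 3 ≤ p → p ≤ D →
        klTowerBLev L M β U μ K d t k p ≤ A * lam ^ (p - 1) * Q ^ p := by
  obtain ⟨C₁, C₂, hC₁, hC₂, h⟩ := klTowerMuLev_le_profileR_base
  refine ⟨C₁, C₂, hC₁, hC₂, fun R hR2 => ?_⟩
  obtain ⟨c₃, hc₃, U₀, hU₀, h'⟩ := h R hR2
  refine ⟨c₃, hc₃, U₀, hU₀, ?_⟩
  intro P c hP hc hc6 hc₃' μ hμ U hU hU9 hU₀' β hβmin hβc K hK L M _ _ hL3 hM3 d Kb D hd hKbN hD A lam Q Ab Qb hA hlam hQ hAb hQb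
    Nb hNb0 hcar hlawb W Z A' Q' hW hZ hA'1 hQ'1 hQ'0 σ Φ ψ τ ι₁ ι₂ ι₃ X hσ hΦ hψ hτ hXι hAQι hbase hbase3 hι₁ hι₂ hcell hstep
    hx₁ hx₂ hx₃ hy hθ hu₁ hu₂ hclose
  have hβ : 0 < β := KLRegimeSplit.pos_of_klBetaMin_le hβmin
  -- the profile constants of the base `R` rows and their domination by `A′, Q′`
  set AR : ℝ := (27 : ℝ) ^ 5 * (C₁ / C₂) * (8 : ℝ) ^ (d - 1) * (Ab + A / (1 - (Real.sqrt 2 ^ d)⁻¹)) with hAR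
  set QR : ℝ := C₂ ^ 2 * ((2 : ℝ) ^ (d - 1))⁻¹ * max Q Qb with hQR
  have hρ1 : (Real.sqrt 2 ^ d)⁻¹ < 1 := by
    have hs1 : 1 ≤ Real.sqrt 2 := Real.one_le_sqrt.2 (by norm_num)
    have h2 : Real.sqrt 2 ^ 2 = 2 := Real.sq_sqrt (by norm_num)
    have : (1 : ℝ) < Real.sqrt 2 ^ d := by
      calc (1 : ℝ) < 2 := by norm_num
        _ = Real.sqrt 2 ^ 2 := h2.symm
        _ ≤ Real.sqrt 2 ^ d := pow_le_pow_right₀ hs1 hd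
    exact inv_lt_one_of_one_lt₀ this
  have hAR0 : 0 ≤ AR := by
    have : 0 ≤ A / (1 - (Real.sqrt 2 ^ d)⁻¹) := div_nonneg hA (sub_nonneg.2 hρ1.le)
    positivity
  have hQR0 : 0 ≤ QR := by
    have : 0 ≤ max Q Qb := le_max_of_le_left hQ.le
    positivity
  have hA'0 : 0 ≤ A' := le_trans (by positivity) hA'1
  have hdom : ∀ m : ℕ, W * Z ^ m * (AR * lam ^ (m - 1) * QR ^ m) ≤ A' * lam ^ (m - 1) * Q' ^ m := fun m => by
    rw [show W * Z ^ m * (AR * lam ^ (m - 1) * QR ^ m) = W * AR * lam ^ (m - 1) * (Z * QR) ^ m by rw [mul_pow]; ring]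
    exact mul_le_mul (mul_le_mul_of_nonneg_right hA'1 (pow_nonneg hlam.le _)) (pow_le_pow_left₀ (by positivity) hQ'1 m)
      (pow_nonneg (by positivity) _) (by positivity)
  have hWZ : ∀ m : ℕ, 0 ≤ W * Z ^ m := fun m => by positivity
  have hkN : ∀ k, k < Kb → d * k - 1 ≤ nScales β + 1 := fun k hk =>
    le_trans (Nat.sub_le_sub_right (Nat.mul_le_mul_left d hk.le) 1) hKbN
  refine klTowerBLev_le_law_of_inputs_base hβ U μ K d Kb D hA hlam hQ.le hW.le hZ.le hA'0 hQ'0 hσ hΦ hψ hτ hbase hbase3 ?_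
    hι₁ hι₂ hstep hx₁ hx₂ hx₃ hy hθ hu₁ hu₂ hclose
  -- the bridge `hR` at the blocks `k ≥ 2`, from the re-based `R` rows
  intro k hk2 hkK ih
  have hrow := h' P c hP hc hc6 hc₃' μ hμ U hU hU9 hU₀' β hβmin hβc K hK L M hL3 hM3 d k hd hk2 (hkN k hkK) D A lam Q Ab Qb hA hlam.le hQ.le hAb hQb
    Nb hNb0 hcar hlawb ih
  refine ⟨fun m hm hmD => (mul_le_mul_of_nonneg_left (hrow.1 m hm hmD) (hWZ m)).trans (hdom m), fun hD3 => ?_⟩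
  refine (mul_le_mul_of_nonneg_left (hrow.2 (X * lam ^ 2) hD3 (hcell k hk2 hkK)) (hWZ 3)).trans ?_
  rw [mul_max_of_nonneg _ _ (hWZ 3)]
  refine max_le ?_ ?_
  · calc W * Z ^ 3 * (X * lam ^ 2) = W * Z ^ 3 * X * lam ^ 2 := by ring
      _ ≤ ι₃ * lam ^ 2 := mul_le_mul_of_nonneg_right hXι (sq_nonneg _)
  · calc W * Z ^ 3 * (AR * lam ^ 2 * QR ^ 3) = W * Z ^ 3 * (AR * lam ^ (3 - 1) * QR ^ 3) := by norm_num
      _ ≤ A' * lam ^ (3 - 1) * Q' ^ 3 := hdom 3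
      _ = A' * Q' ^ 3 * lam ^ 2 := by ring
      _ ≤ ι₃ * lam ^ 2 := mul_le_mul_of_nonneg_right hAQι (sq_nonneg _)

end Summit.HubbardSuperconductivity.HubbardSuperconductivity.Theorems.EngineV8

end
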